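/-
Copyright: harness cell b2b-lgcu-borel (gen 16).  Honest framing: the VALUE here is a THEOREM
(all primes, unconditional) — NOT summit progress; the crux item `SubgroupIdentityDesigns`
(stmt-MatrixMultiplication-14079) stays open and untouched.
-/
import Mathlib
import Summits.MatrixMultiplication.MatrixMultiplication.Theorems.SubgroupIdentityDesigns.Negative.NearFloorVolume

/-!
# The family-I gap for every `ε < 1`: an explicit prime threshold `p ≥ 2 + 3/(4(1-ε))`

Route `LevelGradedCohnUmans`, crux `SubgroupIdentityDesigns`, negative side, cell `(m,k) = (2,1)`.
`NearFloorVolume` kills every triple of volume `V ≤ (p-1)(p+1)³` (the family-I volume) as a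
level-one witness whenever the GAP INEQUALITY `(p-1)^{(2+ε)/3} ≤ p-2` holds, and proves the gap for
`p ≥ 61`, `ε ≤ 0.98`.  Here the gap is proved for EVERY `ε < 1` beyond an explicit threshold:

* `gap_of_log_bound` — `(p-1)^{(2+ε)/3} ≤ p-2` as soon as `3/(1-ε) ≤ (p-2) log (p-1)` (`p ≥ 3`,
  `ε < 1`); from `log (x/(x-1)) ≤ 1/(x-1)`;
* `four_le_log_sixty`, `gap_of_explicit` — hence for `p ≥ 61` as soon as `p ≥ 2 + 3/(4(1-ε))`;
* **`no_levelOne_witness_familyI_explicit`** — for all primes `p ≥ max(61, 2 + 3/(4(1-ε)))` and all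
  `-2 < ε < 1`, NO triple of volume `≤ (p-1)(p+1)³` satisfies the level-one crux inequality.

So for each fixed `ε < 1` the family-I volume can beat the level-one budget only at the finitely
many primes `p < 2 + 3/(4(1-ε))` (e.g. none `≥ 77` for `ε = 0.99`, none `≥ 752` for `ε = 0.999`);
combined with `DicksonReduction` / `DicksonFamilyI` (mod Dickson every `(2,1)` witness for `ε ≤ 1`,
`p ≥ 61` has family-I volume) this confines the `(2,1)` cell, for every `ε < 1`, to an explicit
finite set of primes (see `FamilyIArithmetic.no_levelOne_witness_of_dicksonList_explicit`).

VALUE = THEOREM (unconditional, all `p`), NOT summit progress; the crux item is untouched and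
remains open (at `ε = 1` exactly the gap fails for every `p`, and the cell's status there rests on
the design-existence DATA of ORACLE-g16 §G16-4/5).
-/

set_option linter.dupNamespace false

noncomputable section

open scoped Classical
open Summit.MatrixMultiplication.MatrixMultiplication.Theorems.LieRankDesigns.Negative (GLm Mat budget)

namespace Summit.MatrixMultiplication.MatrixMultiplication.Theorems.SubgroupIdentityDesigns.Negative

section LogGap

variable {p : ℕ} [hp : Fact p.Prime]

omit hp in
/-- **Gap from a logarithmic bound**: `(p-1)^{(2+ε)/3} ≤ p - 2` whenever `p ≥ 3`, `ε < 1` and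
`3/(1-ε) ≤ (p-2) · log (p-1)`. -/
theorem gap_of_log_bound (hp3 : 3 ≤ p) {ε : ℝ} (hε1 : ε < 1)
    (h : 3 / (1 - ε) ≤ ((p : ℝ) - 2) * Real.log ((p : ℝ) - 1)) :
    ((p : ℝ) - 1) ^ ((2 + ε) / 3) ≤ (p : ℝ) - 2 := by
  have hpR : (3 : ℝ) ≤ p := by exact_mod_cast hp3
  set x : ℝ := (p : ℝ) - 1 with hx
  have e1 : (p : ℝ) - 2 = x - 1 := by rw [hx]; ring
  rw [e1] at h ⊢
  have hx2 : (2 : ℝ) ≤ x := by rw [hx]; linarith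
  have hx0 : 0 < x := by linarith
  have hx1 : 0 < x - 1 := by linarith
  have hε' : 0 < 1 - ε := by linarith
  -- 1/(x-1) ≤ (1-ε)/3 · log x
  have h4 : 1 / (x - 1) ≤ (1 - ε) / 3 * Real.log x := by
    rw [div_le_iff₀ hε'] at h
    rw [div_le_iff₀ hx1,
      show (1 - ε) / 3 * Real.log x * (x - 1) = ((x - 1) * Real.log x * (1 - ε)) / 3 by ring,
      le_div_iff₀ (by norm_num : (0 : ℝ) < 3)]
    linarith
  -- log x · (ε-1)/3 ≤ log ((x-1)/x)
  have key : Real.log x * ((ε - 1) / 3) ≤ Real.log ((x - 1) / x) := by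
    have h1 : Real.log (x / (x - 1)) ≤ x / (x - 1) - 1 :=
      Real.log_le_sub_one_of_pos (div_pos hx0 hx1)
    have h2 : x / (x - 1) - 1 = 1 / (x - 1) := by
      field_simp
      ring
    rw [h2] at h1
    have h3 : Real.log ((x - 1) / x) = -Real.log (x / (x - 1)) := by
      rw [← Real.log_inv, inv_div]
    rw [h3, show Real.log x * ((ε - 1) / 3) = -((1 - ε) / 3 * Real.log x) by ring]
    linarith
  calc x ^ ((2 + ε) / 3) = x ^ ((1 : ℝ) + (ε - 1) / 3) := by congr 1; ring
    _ = x ^ (1 : ℝ) * x ^ ((ε - 1) / 3) := Real.rpow_add hx0 _ _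
    _ = x * Real.exp (Real.log x * ((ε - 1) / 3)) := by
        rw [Real.rpow_one, Real.rpow_def_of_pos hx0]
    _ ≤ x * Real.exp (Real.log ((x - 1) / x)) :=
        mul_le_mul_of_nonneg_left (Real.exp_le_exp.mpr key) hx0.le
    _ = x * ((x - 1) / x) := by rw [Real.exp_log (div_pos hx1 hx0)]
    _ = x - 1 := by field_simp

/-- `log 60 ≥ 4` (`e⁴ < 54.6`). -/
theorem four_le_log_sixty : (4 : ℝ) ≤ Real.log 60 := by
  rw [Real.le_log_iff_exp_le (by norm_num)]
  have h1 := Real.exp_one_lt_d9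
  have h4 : Real.exp 4 = Real.exp 1 ^ 4 := by
    rw [← Real.exp_nat_mul]; norm_num
  rw [h4]
  have h0 : 0 ≤ Real.exp 1 := (Real.exp_pos 1).le
  calc Real.exp 1 ^ 4 ≤ (2.7182818286 : ℝ) ^ 4 := pow_le_pow_left₀ h0 h1.le 4
    _ ≤ 60 := by norm_num

omit hp in
/-- **Explicit gap**: for `p ≥ 61` and `ε < 1`, `(p-1)^{(2+ε)/3} ≤ p - 2` as soon as
`p ≥ 2 + 3/(4(1-ε))`. -/
theorem gap_of_explicit (hp61 : 61 ≤ p) {ε : ℝ} (hε1 : ε < 1)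
    (hpε : 2 + 3 / (4 * (1 - ε)) ≤ (p : ℝ)) :
    ((p : ℝ) - 1) ^ ((2 + ε) / 3) ≤ (p : ℝ) - 2 := by
  have hpR : (61 : ℝ) ≤ p := by exact_mod_cast hp61
  have hε' : 0 < 1 - ε := by linarith
  apply gap_of_log_bound (by omega) hε1
  have hlog : (4 : ℝ) ≤ Real.log ((p : ℝ) - 1) :=
    four_le_log_sixty.trans (Real.log_le_log (by norm_num) (by linarith))
  have h1 : 3 / (1 - ε) ≤ ((p : ℝ) - 2) * 4 := by
    have h2 : 3 / (4 * (1 - ε)) ≤ (p : ℝ) - 2 := by linarith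
    rw [div_le_iff₀ (by positivity)] at h2
    rw [div_le_iff₀ hε']
    linarith
  exact h1.trans (mul_le_mul_of_nonneg_left hlog (by linarith))

/-- **FAMILY-I CEILING FOR EVERY `ε < 1` (all primes `p ≥ max(61, 2 + 3/(4(1-ε)))`).**  No triple
`H₁, H₂, H₃ ≤ GL₂(𝔽_p)` of volume `|H₁||H₂||H₃| ≤ (p-1)(p+1)³` satisfies the level-one crux
inequality `budget p 2 1 (2+ε) < (|H₁||H₂||H₃|)^{(2+ε)/3}`. -/
theorem no_levelOne_witness_familyI_explicit (hp61 : 61 ≤ p) {ε : ℝ} (hε : -2 < ε)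
    (hε1 : ε < 1) (hpε : 2 + 3 / (4 * (1 - ε)) ≤ (p : ℝ)) {H₁ H₂ H₃ : Subgroup (GLm p 2)}
    (hV : Nat.card H₁ * Nat.card H₂ * Nat.card H₃ ≤ (p - 1) * (p + 1) ^ 3) :
    ¬ budget p 2 1 (2 + ε) <
      ((Nat.card H₁ * Nat.card H₂ * Nat.card H₃ : ℕ) : ℝ) ^ ((2 + ε) / 3) :=
  no_levelOne_witness_of_volume_le_familyI_nat hε hV (gap_of_explicit hp61 hε1 hpε)

/-- The same with the logarithmic threshold `3/(1-ε) ≤ (p-2) log (p-1)` (`p ≥ 3`). -/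
theorem no_levelOne_witness_familyI_log (hp3 : 3 ≤ p) {ε : ℝ} (hε : -2 < ε)
    (hε1 : ε < 1) (h : 3 / (1 - ε) ≤ ((p : ℝ) - 2) * Real.log ((p : ℝ) - 1))
    {H₁ H₂ H₃ : Subgroup (GLm p 2)}
    (hV : Nat.card H₁ * Nat.card H₂ * Nat.card H₃ ≤ (p - 1) * (p + 1) ^ 3) :
    ¬ budget p 2 1 (2 + ε) <
      ((Nat.card H₁ * Nat.card H₂ * Nat.card H₃ : ℕ) : ℝ) ^ ((2 + ε) / 3) :=
  no_levelOne_witness_of_volume_le_familyI_nat hε hV (gap_of_log_bound hp3 hε1 h)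

end LogGap

end Summit.MatrixMultiplication.MatrixMultiplication.Theorems.SubgroupIdentityDesigns.Negative

end
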